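import Summits.CriticalPhenomena.CardyFormulaZ2.Theorems.UniformBoxCrossing.Negative.LaminatedPaths
import Literature.Probability.LatticeModels.ProdBernoulliThinning
import Literature.Probability.LatticeModels.ProdBernoulliCoupling
import Literature.Probability.Percolation.KSTPeriodicDualMeasure
import Literature.Probability.Percolation.RSW
import HarnessLib

/-!
# The staircase world: a positively associated, translation- and diagonally-invariant, self-dual
# bond measure on `ℤ²` with exact-`1/2` squares and NO box crossing
(negative-side support for crux `UniformBoxCrossing`, stmt-CriticalPhenomena-5476; line lead c3;
part 1 of 2, continued in `StaircaseWorldNoGo`)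

Randomised version of Köhler-Schindler–Tassion's `ω_diag` (arXiv:2011.04618, Comment 5): partition
the edges of `ℤ²` into the diagonal STAIRCASES
`S_d = {east edge of v : v₀ - v₁ = d} ∪ {north edge of v : v₀ - v₁ = d + 1}` (`E N E N …` along the
direction `(1,1)`), and open ALL of `S_d` iff `d ∈ ξ`, where `ξ ⊆ ℤ` is a fair i.i.d. random set
(`prodBernoulli (fun _ => half)`). This file: the configuration map `stairConfig`, the measure
`stairWorld`, the edge dictionary, the three configuration identities (translation, transposition,
planar duality `dualConfig (stairConfig ξ) = stairConfig ξᶜ`), positive association, and the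
deterministic LEVEL LEMMA: an open path raises the level `v₀ - v₁` from `d` to `d + 1` only along an
edge of `S_d`, so every level between the levels of its endpoints belongs to `ξ`.
-/

namespace Summit.CriticalPhenomena.CardyFormulaZ2.Theorems.UniformBoxCrossing.Negative

open MeasureTheory Filter Literature.Probability.Percolation Literature.Probability.LatticeModels
open scoped Topology

noncomputable section

/-! ### The staircase configuration and the staircase world -/

/-- The LEVEL `v₀ - v₁` of a vertex of `ℤ²` (constant along anti-diagonals, raised by `1` by an
east or a south step). -/
def stairLevel (v : Site 2) : ℤ := v 0 - v 1

/-- The staircase index of the edge `cornerEdge (v, j)`: the east edge of `v` lies on the staircase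
`S_{v₀ - v₁}`, the north edge of `v` on `S_{v₀ - v₁ - 1}`. -/
def stairIdx (i : Site 2 × Fin 2) : ℤ := if i.2 = 0 then stairLevel i.1 else stairLevel i.1 - 1

/-- The staircase configuration of `ξ ⊆ ℤ`: open every edge whose staircase index lies in `ξ`. -/
def stairConfig (ξ : Set ℤ) : BondConfig (Site 2) := edgeConfig {i | stairIdx i ∈ ξ}

/-- **The staircase world**: the law of `stairConfig ξ` for a fair i.i.d. random set `ξ ⊆ ℤ`. -/
def stairWorld : Measure (BondConfig (Site 2)) :=
  (prodBernoulli fun _ : ℤ => half).map stairConfig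

/-- `stairIdx` of an east edge. -/
@[simp] theorem stairIdx_zero (v : Site 2) : stairIdx (v, 0) = stairLevel v := rfl

/-- `stairIdx` of a north edge. -/
@[simp] theorem stairIdx_one (v : Site 2) : stairIdx (v, 1) = stairLevel v - 1 := by
  simp [stairIdx]

/-- Membership of a lattice edge in the staircase configuration. -/
@[simp] theorem cornerEdge_mem_stairConfig_iff (ξ : Set ℤ) (i : Site 2 × Fin 2) :
    cornerEdge i ∈ stairConfig ξ ↔ stairIdx i ∈ ξ := by
  rw [stairConfig, cornerEdge_mem_edgeConfig_iff]; rfl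

/-- Staircase configurations consist of lattice edges. -/
theorem stairConfig_subset_edgeSet (ξ : Set ℤ) : stairConfig ξ ⊆ (zdGraph 2).edgeSet :=
  edgeConfig_subset_edgeSet _

/-- `stairConfig` is monotone. -/
theorem stairConfig_mono : Monotone stairConfig :=
  fun _ _ h => Set.image_mono fun _ hi => h hi

/-- `stairConfig` is measurable. -/
theorem measurable_stairConfig : Measurable stairConfig :=
  measurable_edgeConfig.comp (measurable_set_iff.2 fun _ => measurable_set_mem _)

/-- The staircase world is a probability measure. -/
instance isProbabilityMeasure_stairWorld : IsProbabilityMeasure stairWorld :=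
  Measure.isProbabilityMeasure_map measurable_stairConfig.aemeasurable

/-- Probabilities under the staircase world are `prodBernoulli` probabilities of preimages. -/
theorem stairWorld_real_apply {A : Set (BondConfig (Site 2))} (hA : MeasurableSet A) :
    stairWorld.real A = (prodBernoulli fun _ : ℤ => half).real (stairConfig ⁻¹' A) :=
  map_measureReal_apply measurable_stairConfig hA

/-! ### Configuration identities: translation, transposition, duality -/

/-- `stairLevel` of a translate. -/
theorem stairLevel_sub (u a : Site 2) : stairLevel (u - a) = stairLevel u - stairLevel a := by
  simp only [stairLevel, Pi.sub_apply]; ring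

/-- `stairIdx` of a translated edge. -/
theorem stairIdx_sub (u a : Site 2) (j : Fin 2) : stairIdx (u - a, j) = stairIdx (u, j) - stairLevel a := by
  fin_cases j
  · simp [stairIdx, stairLevel_sub]
  · simp only [stairIdx, stairLevel_sub, Fin.mk_one, Fin.isValue, one_ne_zero, ↓reduceIte]; ring

/-- **Translation**: translating the staircase configuration by `a` shifts the index set by the
level of `a`. -/
theorem relabel_shift_stairConfig (a : Site 2) (ξ : Set ℤ) :
    BondConfig.relabel (sym2Equiv (Site.shift a)) (stairConfig ξ) =
      stairConfig ((Equiv.addRight (stairLevel a)) '' ξ) := by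
  refine eq_of_forall_cornerEdge_mem_iff
    (relabel_subset_edgeSet (zdShiftIso a) (stairConfig_subset_edgeSet ξ))
    (stairConfig_subset_edgeSet _) ?_
  rintro ⟨u, j⟩
  rw [BondConfig.mem_relabel_iff, sym2Equiv_symm_cornerEdge_shift, cornerEdge_mem_stairConfig_iff,
    cornerEdge_mem_stairConfig_iff, stairIdx_sub, Set.mem_image_equiv]
  rfl

/-- `stairLevel` of the transposed vertex. -/
theorem stairLevel_transpose (u : Site 2) : stairLevel (transposeEquiv u) = -stairLevel u := by
  have h0 : transposeEquiv u 0 = u 1 := transposeIso_apply_zero u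
  have h1 : transposeEquiv u 1 = u 0 := transposeIso_apply_one u
  simp only [stairLevel, h0, h1]; ring

/-- The involution `d ↦ -d - 1` of `ℤ` (the action of the transposition on staircase indices). -/
def negPred : ℤ ≃ ℤ where
  toFun d := -d - 1
  invFun d := -d - 1
  left_inv d := by ring
  right_inv d := by ring

/-- `negPred d = -d - 1`. -/
@[simp] theorem negPred_apply (d : ℤ) : negPred d = -d - 1 := rfl

/-- `negPred` is its own inverse. -/
@[simp] theorem negPred_symm_apply (d : ℤ) : negPred.symm d = -d - 1 := rfl

/-- `stairIdx` of the transposed edge. -/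
theorem stairIdx_transpose (u : Site 2) (j : Fin 2) :
    stairIdx (transposeEquiv u, Equiv.swap (0 : Fin 2) 1 j) = -stairIdx (u, j) - 1 := by
  fin_cases j <;> simp [stairIdx, stairLevel_transpose]

/-- **Transposition**: transposing the staircase configuration maps `S_d` to `S_{-d-1}`. -/
theorem relabel_transpose_stairConfig (ξ : Set ℤ) :
    BondConfig.relabel (sym2Equiv transposeEquiv) (stairConfig ξ) = stairConfig (negPred '' ξ) := by
  refine eq_of_forall_cornerEdge_mem_iff
    (relabel_subset_edgeSet transposeIso (stairConfig_subset_edgeSet ξ))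
    (stairConfig_subset_edgeSet _) ?_
  rintro ⟨u, j⟩
  rw [BondConfig.mem_relabel_iff, sym2Equiv_symm_cornerEdge_transpose, cornerEdge_mem_stairConfig_iff,
    cornerEdge_mem_stairConfig_iff, stairIdx_transpose, Set.mem_image_equiv, negPred_symm_apply]

/-- **Planar duality**: the dual configuration of the staircase configuration of `ξ` is the
staircase configuration of the COMPLEMENT of `ξ` (with the tree's dual-lattice indexing, the dual
edges of `S_d` are exactly the edges of `S_d`, open iff `S_d` is closed). -/
theorem dualConfig_stairConfig (ξ : Set ℤ) : dualConfig (stairConfig ξ) = stairConfig ξᶜ := by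
  refine eq_of_forall_cornerEdge_mem_iff (fun _ h => h.1) (stairConfig_subset_edgeSet _) ?_
  rintro ⟨u, j⟩
  fin_cases j
  · rw [Fin.zero_eta, cornerEdge_zero_mem_dualConfig_iff, cornerEdge_mem_stairConfig_iff,
      cornerEdge_mem_stairConfig_iff, Set.mem_compl_iff]
    simp only [stairIdx, stairLevel, Fin.isValue, one_ne_zero, ↓reduceIte, Pi.add_apply,
      Pi.single_eq_same, Pi.single_eq_of_ne (one_ne_zero (α := Fin 2)), add_zero]
    rw [show u 0 + 1 - u 1 - 1 = u 0 - u 1 by ring]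
  · rw [Fin.mk_one, cornerEdge_one_mem_dualConfig_iff, cornerEdge_mem_stairConfig_iff,
      cornerEdge_mem_stairConfig_iff, Set.mem_compl_iff]
    simp only [stairIdx, stairLevel, Fin.isValue, one_ne_zero, ↓reduceIte, Pi.add_apply,
      Pi.single_eq_same, Pi.single_eq_of_ne (zero_ne_one (α := Fin 2)), add_zero]
    rw [show u 0 - (u 1 + 1) = u 0 - u 1 - 1 by ring]

/-! ### Positive association -/

/-- **The staircase world is positively associated** (Harris–FKG): it is an antitone image of
i.i.d. uniform labels (`ξ = {d | U_d ≤ 1/2}`, then the monotone `stairConfig`). -/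
theorem isPositivelyAssociated_stairWorld : IsPositivelyAssociated stairWorld := by
  haveI : IsProbabilityMeasure ((volume : Measure ℝ).restrict (Set.Icc (0 : ℝ) 1)) :=
    isProbabilityMeasure_volume_restrict_unitInterval
  have hmeas : Measurable fun U : ℤ → ℝ => {i | U i ≤ ((fun _ : ℤ => half) i : ℝ)} :=
    measurable_set_iff.2 fun i =>
      (show Measurable fun t : ℝ => (t ≤ ((half : unitInterval) : ℝ)) from
        measurableSet_setOf.1 measurableSet_Iic).comp (measurable_pi_apply i)
  have hanti : Antitone (stairConfig ∘ fun U : ℤ → ℝ => {i | U i ≤ ((fun _ : ℤ => half) i : ℝ)}) :=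
    fun U U' hUU' => stairConfig_mono fun i (hi : U' i ≤ _) => (hUU' i).trans hi
  rw [stairWorld, prodBernoulli_eq_map_labels, Measure.map_map measurable_stairConfig hmeas]
  exact KSTPeriodic.isPositivelyAssociated_map_of_antitone (isPositivelyAssociated_infinitePi _) hanti
    (measurable_stairConfig.comp hmeas)

/-- The `μ.real` form of Harris–FKG for the staircase world. -/
theorem stairWorld_real_inter_ge {A B : Set (BondConfig (Site 2))}
    (hA : IsUpperSet A) (hB : IsUpperSet B) (hAm : MeasurableSet A) (hBm : MeasurableSet B) :
    stairWorld.real A * stairWorld.real B ≤ stairWorld.real (A ∩ B) :=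
  isPositivelyAssociated_stairWorld.real hA hB hAm hBm

/-! ### Invariances of the measure -/

/-- **Translation invariance of the staircase world.** -/
theorem stairWorld_map_relabel_shift (a : Site 2) :
    stairWorld.map (BondConfig.relabel (sym2Equiv (Site.shift a))) = stairWorld := by
  have hm : Measurable fun ξ : Set ℤ => (Equiv.addRight (stairLevel a)) '' ξ :=
    measurable_set_iff.2 fun i => by
      simp only [Set.mem_image_equiv]; exact measurable_set_mem _
  rw [stairWorld, Measure.map_map (MeasurableEquiv.measurable _) measurable_stairConfig,
    show (BondConfig.relabel (sym2Equiv (Site.shift a)) : BondConfig (Site 2) → BondConfig (Site 2)) ∘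
        stairConfig = stairConfig ∘ fun ξ => (Equiv.addRight (stairLevel a)) '' ξ from
      funext (relabel_shift_stairConfig a),
    ← Measure.map_map measurable_stairConfig hm, prodBernoulli_map_image_equiv _ _ fun _ => rfl]

/-- **Invariance of the staircase world under the transposition of the axes** (the diagonal
reflection `σ`). -/
theorem stairWorld_map_relabel_transpose :
    stairWorld.map (BondConfig.relabel (sym2Equiv transposeIso.toEquiv)) = stairWorld := by
  have hm : Measurable fun ξ : Set ℤ => negPred '' ξ :=
    measurable_set_iff.2 fun i => by
      simp only [Set.mem_image_equiv]; exact measurable_set_mem _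
  rw [transposeIso_toEquiv, stairWorld,
    Measure.map_map (MeasurableEquiv.measurable _) measurable_stairConfig,
    show (BondConfig.relabel (sym2Equiv transposeEquiv) : BondConfig (Site 2) → BondConfig (Site 2)) ∘
        stairConfig = stairConfig ∘ fun ξ => negPred '' ξ from funext relabel_transpose_stairConfig,
    ← Measure.map_map measurable_stairConfig hm, prodBernoulli_map_image_equiv _ _ fun _ => rfl]

/-- **Self-duality of the staircase world**: the dual configuration has the SAME law (not merely
the law of a reflected configuration). -/
theorem stairWorld_map_dualConfig : stairWorld.map dualConfig = stairWorld := by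
  have hm : Measurable (compl : Set ℤ → Set ℤ) :=
    measurable_set_iff.2 fun i => (measurable_set_mem i).not
  rw [stairWorld, Measure.map_map measurable_dualConfig measurable_stairConfig,
    show dualConfig ∘ stairConfig = stairConfig ∘ compl from funext dualConfig_stairConfig,
    ← Measure.map_map measurable_stairConfig hm, prodBernoulli_map_compl]
  simp only [symm_half]

/-- **Invariance of the staircase world under the point reflection `v ↦ -v`** (it maps `S_d` to
`S_{-d-1}`, a measure-preserving reindexing); with `stairWorld_map_dualConfig` this gives the
self-duality in the form of `ExtendedFamilySymmetries` (`map dualConfig = map (point reflection)`). -/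
theorem stairWorld_map_relabel_neg :
    stairWorld.map (BondConfig.relabel (sym2Equiv (Equiv.neg (Site 2)))) = stairWorld := by
  have hcfg : ∀ ξ : Set ℤ, BondConfig.relabel (sym2Equiv (Equiv.neg (Site 2))) (stairConfig ξ) =
      stairConfig (negPred '' ξ) := by
    intro ξ
    refine eq_of_forall_cornerEdge_mem_iff
      (relabel_subset_edgeSet negIso (stairConfig_subset_edgeSet ξ)) (stairConfig_subset_edgeSet _) ?_
    rintro ⟨u, j⟩
    rw [BondConfig.mem_relabel_iff, sym2Equiv_symm_cornerEdge_neg, cornerEdge_mem_stairConfig_iff,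
      cornerEdge_mem_stairConfig_iff, Set.mem_image_equiv, negPred_symm_apply]
    fin_cases j
    · simp only [stairIdx, stairLevel, Fin.zero_eta, Fin.isValue, ↓reduceIte, Pi.sub_apply,
        Pi.neg_apply, Pi.single_eq_same, Pi.single_eq_of_ne (one_ne_zero (α := Fin 2))]
      rw [show -u 0 - 1 - (-u 1 - 0) = -(u 0 - u 1) - 1 by ring]
    · simp only [stairIdx, stairLevel, Fin.mk_one, Fin.isValue, one_ne_zero, ↓reduceIte, Pi.sub_apply,
        Pi.neg_apply, Pi.single_eq_same, Pi.single_eq_of_ne (zero_ne_one (α := Fin 2))]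
      rw [show -u 0 - 0 - (-u 1 - 1) - 1 = -(u 0 - u 1 - 1) - 1 by ring]
  have hm : Measurable fun ξ : Set ℤ => negPred '' ξ :=
    measurable_set_iff.2 fun i => by
      simp only [Set.mem_image_equiv]; exact measurable_set_mem _
  rw [stairWorld, Measure.map_map (MeasurableEquiv.measurable _) measurable_stairConfig,
    show (BondConfig.relabel (sym2Equiv (Equiv.neg (Site 2))) : BondConfig (Site 2) → BondConfig (Site 2)) ∘
        stairConfig = stairConfig ∘ fun ξ => negPred '' ξ from funext hcfg,
    ← Measure.map_map measurable_stairConfig hm, prodBernoulli_map_image_equiv _ _ fun _ => rfl]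

/-! ### The level lemma -/

/-- A lattice step changes the level by `±1`. -/
theorem stairLevel_of_adj {p q : Site 2} (h : (zdGraph 2).Adj p q) :
    stairLevel q = stairLevel p + 1 ∨ stairLevel q = stairLevel p - 1 := by
  obtain ⟨i, h | h⟩ := (zdGraph_adj_iff p q).1 h
  · fin_cases i
    · left; simp [stairLevel, h]; ring
    · right; simp [stairLevel, h]; ring
  · fin_cases i
    · right; simp [stairLevel, h]; ring
    · left; simp [stairLevel, h]; ring

/-- **An open step that raises the level from `d` to `d + 1` is an edge of the staircase `S_d`,
so `d ∈ ξ`.** -/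
theorem stairLevel_mem_of_adj {ξ : Set ℤ} {p q : Site 2} (h : (zdGraph 2).Adj p q)
    (hopen : s(p, q) ∈ stairConfig ξ) (hlev : stairLevel q = stairLevel p + 1) : stairLevel p ∈ ξ := by
  obtain ⟨i, h | h⟩ := (zdGraph_adj_iff p q).1 h
  · fin_cases i
    · have he : s(p, q) = cornerEdge (p, 0) := by rw [h]; rfl
      rw [he, cornerEdge_mem_stairConfig_iff] at hopen
      simpa using hopen
    · exfalso
      simp [stairLevel, h] at hlev
      omega
  · fin_cases i
    · exfalso
      simp [stairLevel, h] at hlev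
      omega
    · have he : s(p, q) = cornerEdge (q, 1) := by rw [h, Sym2.eq_swap]; rfl
      rw [he, cornerEdge_mem_stairConfig_iff] at hopen
      simp only [stairIdx_one] at hopen
      have : stairLevel q - 1 = stairLevel p := by omega
      rwa [this] at hopen

/-- **Level lemma.** Along an open walk every level `d` with `level(start) ≤ d < level(end)` lies
in `ξ` (the walk must raise the level from `d` to `d + 1` somewhere, along an edge of `S_d`). -/
theorem forall_level_mem_of_walk {ξ : Set ℤ} {x y : Site 2} (W : (zdGraph 2).Walk x y)
    (hW : ∀ e ∈ W.edges, e ∈ stairConfig ξ) :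
    ∀ d : ℤ, stairLevel x ≤ d → d < stairLevel y → d ∈ ξ := by
  induction W with
  | nil => intro d h1 h2; omega
  | @cons u v w hadj W' ih =>
    intro d h1 h2
    have hW' : ∀ e ∈ W'.edges, e ∈ stairConfig ξ := fun e he =>
      hW e (by rw [SimpleGraph.Walk.edges_cons]; exact List.mem_cons_of_mem _ he)
    have huv : s(u, v) ∈ stairConfig ξ := hW _ (by rw [SimpleGraph.Walk.edges_cons]; exact List.mem_cons_self)
    by_cases hv : stairLevel v ≤ d
    · exact ih hW' d hv h2
    · rcases stairLevel_of_adj hadj with hl | hl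
      · have hd : d = stairLevel u := by omega
        rw [hd]; exact stairLevel_mem_of_adj hadj huv hl
      · exfalso; omega

/-- **Open crossings of the staircase configuration climb through every intermediate level.** -/
theorem exists_endpoints_of_mem_openCrossing {ξ : Set ℤ} {T A B : Set (Site 2)}
    (h : stairConfig ξ ∈ openCrossing T A B) :
    ∃ x ∈ A, ∃ y ∈ B, x ∈ T ∧ y ∈ T ∧ ∀ d : ℤ, stairLevel x ≤ d → d < stairLevel y → d ∈ ξ := by
  obtain ⟨x, hxA, y, hyB, hconn⟩ := h
  rcases id hconn with ⟨hxT, hyT, -⟩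
  obtain ⟨W, -, hWω⟩ := exists_walk_of_mem_openConnIn (stairConfig_subset_edgeSet ξ) hconn
  exact ⟨x, hxA, y, hyB, hxT, hyT, forall_level_mem_of_walk W hWω⟩

/-! ### Level windows (used in part 2) -/

/-- The `4n` consecutive levels starting at the level of `x`. -/
def levelWindow (x : Site 2) (n : ℕ) : Finset ℤ := Finset.Ico (stairLevel x) (stairLevel x + 4 * n)

/-- The level window has `4n` elements. -/
theorem card_levelWindow (x : Site 2) (n : ℕ) : (levelWindow x n).card = 4 * n := by
  rw [levelWindow, Int.card_Ico, show stairLevel x + 4 * n - stairLevel x = ((4 * n : ℕ) : ℤ) by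
    push_cast; ring]
  exact Int.toNat_natCast _

end

end Summit.CriticalPhenomena.CardyFormulaZ2.Theorems.UniformBoxCrossing.Negative
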